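import Summits.MatrixMultiplication.MatrixMultiplication.Theses.ThinBlockAlpha

/-!
# Negative-side support for crux `ThinBlockAlpha.SkewLocalStrongUSP` (stmt-MatrixMultiplication-10598)

Sorry-free structural facts about the witnesses the crux asks for (skew local strong USPs of
composition `(3k, k, 3k)` in `{0,1,2}^{7k}`), written against the crux's INLINED predicate
(pattern finset `{(0,1,0),(0,1,1),(0,0,2),(0,2,2),(1,1,2),(2,1,2)}` = CKSU §6.1 "exactly two of
`u_i = 1, v_i = 2, w_i = 3`" in `0/1/2` coding):

* `notMem_patterns_iff`, `no_witness_iff` — the Δ-system dictionary: an ordered triple `(u,v,w)`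
  has NO admissible column iff `Z(u) ∩ O(v) = Z(u) ∩ T(w) = O(v) ∩ T(w)` (the zero-set of `u`,
  the one-set of `v` and the two-set of `w` form a sunflower).
* `oneSet_injOn`, `card_le_choose` — the unique-pieces cap `|U| ≤ C(7k, k)` (the crux asks for
  this cap up to the factor `2^{-δk}`).
* `oneSet_ne_of_sandwich` — the FORBIDDEN ONE-SETS lemma: for rows `u ≠ w` of `U` with kernel
  `K = Z(u) ∩ T(w)`, no row `v` of `U` may have `K ⊆ O(v) ⊆ K ∪ (Z(u) ∪ T(w))ᶜ`.
* `exists_witness_of_common_oneSet` — WHAT IS LOAD-BEARING: rows sharing one one-set never form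
  a bad triple of pairwise distinct rows, so the variant of the crux quantifying over pairwise
  distinct triples only is trivially true (all `C(6k,3k)` rows with a fixed one-set); the content
  is in the degenerate triples (injectivity).
* `lt_card_inter_of_choose_le_card` — consequence: a witness family MEETING the cap exactly has
  `|Z(u) ∩ T(w)| ≥ k + 1` for all rows `u ≠ w`; with Füredi's threshold form of the Bollobás
  set-pair inequality this caps such families at `C(4k, 2k) < C(7k, k)` (see the crux work file
  `Cruxes/SkewLocalStrongUSP/Disproof.lean`), so the slack `2^{-δk}` cannot be dropped.
-/

namespace Summit.MatrixMultiplication.MatrixMultiplication.Theorems.SkewLocalStrongUSP.Negative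

open Finset

/-- Pointwise form of the pattern condition: `(a,b,c)` is NOT an admissible column pattern iff the
three events `a = 0`, `b = 1`, `c = 2` do not hold for exactly two of them, i.e. iff the pairwise
conjunctions all agree. [folklore] -/
theorem notMem_patterns_iff (a b c : Fin 3) :
    (a, b, c) ∉ ({((0 : Fin 3), (1 : Fin 3), (0 : Fin 3)), (0, 1, 1), (0, 0, 2), (0, 2, 2), (1, 1, 2),
        (2, 1, 2)} : Finset (Fin 3 × Fin 3 × Fin 3)) ↔
      ((a = 0 ∧ b = 1 ↔ a = 0 ∧ c = 2) ∧ (a = 0 ∧ b = 1 ↔ b = 1 ∧ c = 2)) := by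
  revert a b c
  decide

/-- **Δ-system dictionary.** An ordered triple of rows `(u, v, w)` has no admissible column iff
`Z(u) ∩ O(v) = Z(u) ∩ T(w) = O(v) ∩ T(w)`, where `Z`, `O`, `T` are the coordinate sets carrying
the symbols `0`, `1`, `2`. [folklore] -/
theorem no_witness_iff {n : ℕ} (u v w : Fin n → Fin 3) :
    (¬ ∃ i, (u i, v i, w i) ∈ ({((0 : Fin 3), (1 : Fin 3), (0 : Fin 3)), (0, 1, 1), (0, 0, 2),
        (0, 2, 2), (1, 1, 2), (2, 1, 2)} : Finset (Fin 3 × Fin 3 × Fin 3))) ↔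
      ((univ.filter fun i => u i = 0) ∩ (univ.filter fun i => v i = 1) =
          (univ.filter fun i => u i = 0) ∩ (univ.filter fun i => w i = 2) ∧
        (univ.filter fun i => u i = 0) ∩ (univ.filter fun i => v i = 1) =
          (univ.filter fun i => v i = 1) ∩ (univ.filter fun i => w i = 2)) := by
  simp only [not_exists, Finset.ext_iff, mem_inter, mem_filter, mem_univ, true_and]
  constructor
  · intro h
    exact ⟨fun i => ((notMem_patterns_iff _ _ _).1 (h i)).1,
      fun i => ((notMem_patterns_iff _ _ _).1 (h i)).2⟩
  · rintro ⟨h1, h2⟩ i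
    exact (notMem_patterns_iff _ _ _).2 ⟨h1 i, h2 i⟩

/-- The one-set map `u ↦ O(u)` is injective on any local strong USP (apply the condition to the
ordered triple `(u, v, u)`: the only patterns with equal outer letters are `(0,1,0)` and `(2,1,2)`).
[folklore] -/
theorem oneSet_injOn {n : ℕ} (U : Finset (Fin n → Fin 3))
    (hU : ∀ u ∈ U, ∀ v ∈ U, ∀ w ∈ U, (u ≠ v ∨ v ≠ w) → ∃ i, (u i, v i, w i) ∈
      ({((0 : Fin 3), (1 : Fin 3), (0 : Fin 3)), (0, 1, 1), (0, 0, 2), (0, 2, 2), (1, 1, 2),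
        (2, 1, 2)} : Finset (Fin 3 × Fin 3 × Fin 3))) :
    Set.InjOn (fun u : Fin n → Fin 3 => univ.filter fun i => u i = 1) (U : Set (Fin n → Fin 3)) := by
  intro u hu v hv huv
  by_contra hne
  obtain ⟨i, hi⟩ := hU u hu v hv u hu (Or.inl hne)
  have key : v i = 1 ∧ u i ≠ 1 := by
    simp only [mem_insert, mem_singleton, Prod.mk.injEq] at hi
    rcases hi with ⟨h1, h2, h3⟩ | ⟨h1, h2, h3⟩ | ⟨h1, h2, h3⟩ | ⟨h1, h2, h3⟩ | ⟨h1, h2, h3⟩ |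
        ⟨h1, h2, h3⟩
    · exact ⟨h2, by rw [h1]; decide⟩
    · rw [h1] at h3; exact absurd h3 (by decide)
    · rw [h1] at h3; exact absurd h3 (by decide)
    · rw [h1] at h3; exact absurd h3 (by decide)
    · rw [h1] at h3; exact absurd h3 (by decide)
    · exact ⟨h2, by rw [h1]; decide⟩
  have hmem : i ∈ univ.filter fun j => v j = 1 := by simp [key.1]
  have huv' : (univ.filter fun j => u j = 1) = univ.filter fun j => v j = 1 := huv
  rw [← huv'] at hmem
  simp only [mem_filter, mem_univ, true_and] at hmem
  exact key.2 hmem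

/-- **Unique-pieces cap.** A local strong USP all of whose rows have exactly `k` ones, inside
`{0,1,2}^{7k}`, has at most `C(7k, k)` rows. (The crux `SkewLocalStrongUSP` asks for
`|U| ≥ C(7k,k) · 2^{-δk}`, i.e. for this cap up to a subexponential-in-`7k` factor.) [folklore] -/
theorem card_le_choose {k : ℕ} (U : Finset (Fin (7 * k) → Fin 3))
    (hU : ∀ u ∈ U, ∀ v ∈ U, ∀ w ∈ U, (u ≠ v ∨ v ≠ w) → ∃ i, (u i, v i, w i) ∈
      ({((0 : Fin 3), (1 : Fin 3), (0 : Fin 3)), (0, 1, 1), (0, 0, 2), (0, 2, 2), (1, 1, 2),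
        (2, 1, 2)} : Finset (Fin 3 × Fin 3 × Fin 3)))
    (hO : ∀ u ∈ U, (univ.filter fun i => u i = 1).card = k) :
    U.card ≤ (7 * k).choose k := by
  calc U.card ≤ ((univ : Finset (Fin (7 * k))).powersetCard k).card :=
        Finset.card_le_card_of_injOn (fun u : Fin (7 * k) → Fin 3 => univ.filter fun i => u i = 1)
          (fun u hu => Finset.mem_coe.2 (mem_powersetCard.2 ⟨filter_subset _ _, hO u (Finset.mem_coe.1 hu)⟩))
          (oneSet_injOn U hU)
    _ = (7 * k).choose k := by
        rw [card_powersetCard, card_univ, Fintype.card_fin]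

/-- **Forbidden one-sets.** If `u ≠ w` are rows of a local strong USP `U` and a set `S` of
coordinates is sandwiched as `Z(u) ∩ S = Z(u) ∩ T(w) = S ∩ T(w)` (equivalently
`K ⊆ S ⊆ K ∪ (Z(u) ∪ T(w))ᶜ` with `K = Z(u) ∩ T(w)`), then `S` is the one-set of NO row of `U`:
otherwise `(u, v, w)` would be a triple without an admissible column. [folklore] -/
theorem oneSet_ne_of_sandwich {n : ℕ} (U : Finset (Fin n → Fin 3))
    (hU : ∀ u ∈ U, ∀ v ∈ U, ∀ w ∈ U, (u ≠ v ∨ v ≠ w) → ∃ i, (u i, v i, w i) ∈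
      ({((0 : Fin 3), (1 : Fin 3), (0 : Fin 3)), (0, 1, 1), (0, 0, 2), (0, 2, 2), (1, 1, 2),
        (2, 1, 2)} : Finset (Fin 3 × Fin 3 × Fin 3)))
    {u w : Fin n → Fin 3} (hu : u ∈ U) (hw : w ∈ U) (huw : u ≠ w) (S : Finset (Fin n))
    (h1 : (univ.filter fun i => u i = 0) ∩ S =
      (univ.filter fun i => u i = 0) ∩ (univ.filter fun i => w i = 2))
    (h2 : (univ.filter fun i => u i = 0) ∩ S = S ∩ (univ.filter fun i => w i = 2)) :
    ∀ v ∈ U, (univ.filter fun i => v i = 1) ≠ S := by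
  intro v hv hvS
  have hne : u ≠ v ∨ v ≠ w := by
    by_cases h : u = v
    · right
      rw [← h]
      exact huw
    · exact Or.inl h
  have hex := hU u hu v hv w hw hne
  refine (no_witness_iff u v w).2 ?_ hex
  rw [hvS]
  exact ⟨h1, h2⟩

/-- In a row with `3k` zeros and `k` ones (width `7k`) the two-set has `3k` elements. [folklore] -/
theorem card_twoSet {k : ℕ} (u : Fin (7 * k) → Fin 3)
    (h0 : (univ.filter fun i => u i = 0).card = 3 * k) (h1 : (univ.filter fun i => u i = 1).card = k) :
    (univ.filter fun i => u i = 2).card = 3 * k := by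
  have hA := Finset.card_filter_add_card_filter_not (s := (univ : Finset (Fin (7 * k))))
    (fun i => u i = 0)
  have hB := Finset.card_filter_add_card_filter_not
    (s := (univ : Finset (Fin (7 * k))).filter fun i => ¬ u i = 0) (fun i => u i = 1)
  rw [Finset.filter_filter, Finset.filter_filter] at hB
  have e1 : (univ.filter fun i => ¬u i = 0 ∧ u i = 1) = univ.filter fun i => u i = 1 := by
    apply Finset.filter_congr
    intro i _
    constructor
    · exact fun h => h.2
    · intro h
      rw [h]
      exact ⟨by decide, rfl⟩
  have e2 : (univ.filter fun i => ¬u i = 0 ∧ ¬u i = 1) = univ.filter fun i => u i = 2 := by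
    apply Finset.filter_congr
    intro i _
    have : ∀ a : Fin 3, (¬a = 0 ∧ ¬a = 1) ↔ a = 2 := by decide
    exact this (u i)
  rw [e1, e2, h1] at hB
  rw [h0, card_univ, Fintype.card_fin] at hA
  omega

/-- **A family meeting the cap has only thick cross-intersections.** If a local strong USP in the
class `(3k, k, 3k)` has (at least, hence exactly) `C(7k, k)` rows, then every `k`-set of
coordinates is the one-set of some row, and consequently `|Z(u) ∩ T(w)| ≥ k + 1` for all rows
`u ≠ w` (otherwise the kernel `K = Z(u) ∩ T(w)` extends inside `(Z(u) ∪ T(w))ᶜ`, which has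
`k + |K|` elements, to a `k`-set that is forbidden by `oneSet_ne_of_sandwich` yet realised).
Füredi's threshold version of the Bollobás two-families theorem then bounds the number of rows by
`C(4k, 2k) < C(7k, k)` — so the cap is never met (`k ≥ 1`); see the crux work file. [folklore] -/
theorem lt_card_inter_of_choose_le_card {k : ℕ} (U : Finset (Fin (7 * k) → Fin 3))
    (hU : ∀ u ∈ U, ∀ v ∈ U, ∀ w ∈ U, (u ≠ v ∨ v ≠ w) → ∃ i, (u i, v i, w i) ∈
      ({((0 : Fin 3), (1 : Fin 3), (0 : Fin 3)), (0, 1, 1), (0, 0, 2), (0, 2, 2), (1, 1, 2),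
        (2, 1, 2)} : Finset (Fin 3 × Fin 3 × Fin 3)))
    (hS : ∀ u ∈ U, (univ.filter fun i => u i = 0).card = 3 * k ∧ (univ.filter fun i => u i = 1).card = k)
    (hcard : (7 * k).choose k ≤ U.card) :
    ∀ u ∈ U, ∀ w ∈ U, u ≠ w →
      k < ((univ.filter fun i => u i = 0) ∩ (univ.filter fun i => w i = 2)).card := by
  classical
  -- every k-set of coordinates is realised as a one-set
  have hsurj : ∀ S ∈ (univ : Finset (Fin (7 * k))).powersetCard k, ∃ v ∈ U,
      (univ.filter fun i => v i = 1) = S := by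
    intro S hSmem
    have h := Finset.surj_on_of_inj_on_of_card_le
      (s := U) (t := (univ : Finset (Fin (7 * k))).powersetCard k)
      (fun u _ => univ.filter fun i => u i = 1)
      (fun u hu => by
        rw [mem_powersetCard]
        exact ⟨filter_subset _ _, (hS u hu).2⟩)
      (fun a b ha hb hab => oneSet_injOn U hU ha hb hab)
      (by rwa [card_powersetCard, card_univ, Fintype.card_fin])
      S hSmem
    obtain ⟨v, hv, hvS⟩ := h
    exact ⟨v, hv, hvS.symm⟩
  intro u hu w hw huw
  by_contra hle
  rw [Nat.not_lt] at hle
  set Z : Finset (Fin (7 * k)) := univ.filter fun i => u i = 0 with hZ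
  set T : Finset (Fin (7 * k)) := univ.filter fun i => w i = 2 with hT
  set K : Finset (Fin (7 * k)) := Z ∩ T with hK
  set R : Finset (Fin (7 * k)) := (Z ∪ T)ᶜ with hR
  have hZc : Z.card = 3 * k := (hS u hu).1
  have hTc : T.card = 3 * k := card_twoSet w (hS w hw).1 (hS w hw).2
  have hKZT : K = Z ∩ T := hK
  have hRc : R.card = k + K.card := by
    have h1 := Finset.card_union_add_card_inter Z T
    rw [← hKZT] at h1
    have h2 : R.card = 7 * k - (Z ∪ T).card := by
      rw [hR, Finset.card_compl, Fintype.card_fin]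
    have h3 : (Z ∪ T).card ≤ 7 * k := by
      calc (Z ∪ T).card ≤ (univ : Finset (Fin (7 * k))).card := card_le_card (subset_univ _)
        _ = 7 * k := by rw [card_univ, Fintype.card_fin]
    have h4 : K.card ≤ 3 * k := by
      calc K.card ≤ Z.card := card_le_card inter_subset_left
        _ = 3 * k := hZc
    omega
  -- extend the kernel K inside R to a k-set S
  obtain ⟨Q, hQR, hQc⟩ : ∃ Q ⊆ R, Q.card = k - K.card :=
    Finset.exists_subset_card_eq (by omega)
  have hQZ : Disjoint Q Z := by
    rw [Finset.disjoint_left]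
    intro i hiQ hiZ
    have hiR := hQR hiQ
    rw [hR, mem_compl] at hiR
    exact hiR (mem_union_left _ hiZ)
  have hQT : Disjoint Q T := by
    rw [Finset.disjoint_left]
    intro i hiQ hiT
    have hiR := hQR hiQ
    rw [hR, mem_compl] at hiR
    exact hiR (mem_union_right _ hiT)
  have hKQ : Disjoint K Q := by
    rw [Finset.disjoint_left]
    intro i hiK hiQ
    exact (Finset.disjoint_left.1 hQZ) hiQ (inter_subset_left hiK)
  set S : Finset (Fin (7 * k)) := K ∪ Q with hSdef
  have hSc : S.card = k := by
    rw [hSdef, card_union_of_disjoint hKQ, hQc]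
    omega
  have hSmem : S ∈ (univ : Finset (Fin (7 * k))).powersetCard k := by
    rw [mem_powersetCard]
    exact ⟨subset_univ _, hSc⟩
  obtain ⟨v, hv, hvS⟩ := hsurj S hSmem
  -- the sandwich identities
  have e1 : Z ∩ S = Z ∩ T := by
    rw [hSdef, inter_union_distrib_left, disjoint_iff_inter_eq_empty.1 hQZ.symm, union_empty, hK]
    rw [← inter_assoc, inter_self]
  have e2 : Z ∩ S = S ∩ T := by
    rw [e1, hSdef, union_inter_distrib_right, disjoint_iff_inter_eq_empty.1 hQT, union_empty, hK,
      inter_assoc, inter_self]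
  exact oneSet_ne_of_sandwich U hU hu hw huw S e1 e2 v hv hvS

/-- **The degenerate triples are what bites.** If three rows `u, v, w` share the same one-set and
`u ≠ w` have zero-sets of equal size, then `(u, v, w)` HAS an admissible column. Hence the family
of ALL rows of the class `(3k, k, 3k)` with one fixed one-set — `C(6k, 3k) ≫ C(7k, k)` rows —
satisfies the crux's column condition on every triple of pairwise DISTINCT rows: the variant of
`SkewLocalStrongUSP` quantifying only over pairwise distinct triples is trivially true, and all the
content of the crux sits in the degenerate triples `(u,v,u)`, `(u,u,w)`, `(u,w,w)` (injectivity of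
the three coordinate-set maps, whence the cap `card_le_choose`). [folklore] -/
theorem exists_witness_of_common_oneSet {n : ℕ} {u v w : Fin n → Fin 3}
    (huv : (univ.filter fun i => u i = 1) = univ.filter fun i => v i = 1)
    (huw1 : (univ.filter fun i => u i = 1) = univ.filter fun i => w i = 1)
    (hZ : (univ.filter fun i => u i = 0).card = (univ.filter fun i => w i = 0).card)
    (huw : u ≠ w) :
    ∃ i, (u i, v i, w i) ∈ ({((0 : Fin 3), (1 : Fin 3), (0 : Fin 3)), (0, 1, 1), (0, 0, 2),
        (0, 2, 2), (1, 1, 2), (2, 1, 2)} : Finset (Fin 3 × Fin 3 × Fin 3)) := by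
  by_contra h
  obtain ⟨e1, _⟩ := (no_witness_iff u v w).1 h
  -- `Z(u) ∩ O(v) = Z(u) ∩ O(u) = ∅`, hence `Z(u) ∩ T(w) = ∅`
  have hempty : (univ.filter fun i => u i = 0) ∩ (univ.filter fun i => w i = 2) = ∅ := by
    rw [← e1, ← huv]
    ext i
    simp only [mem_inter, mem_filter, mem_univ, true_and, notMem_empty, iff_false, not_and]
    intro h0 h1
    rw [h0] at h1
    exact absurd h1 (by decide)
  have hOw : ∀ i, u i = 1 ↔ w i = 1 := fun i => by
    have := congrArg (fun s : Finset (Fin n) => i ∈ s) huw1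
    simpa using this
  -- `Z(u) ⊆ Z(w)`, hence equal (same size)
  have hsub : (univ.filter fun i => u i = 0) ⊆ univ.filter fun i => w i = 0 := by
    intro i hi
    simp only [mem_filter, mem_univ, true_and] at hi ⊢
    have hfin : ∀ a : Fin 3, a = 0 ∨ a = 1 ∨ a = 2 := by decide
    rcases hfin (w i) with h0 | h1 | h2
    · exact h0
    · have := (hOw i).2 h1
      rw [hi] at this
      exact absurd this (by decide)
    · have hmem : i ∈ (univ.filter fun j => u j = 0) ∩ (univ.filter fun j => w j = 2) := by
        simp [hi, h2]
      rw [hempty] at hmem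
      exact absurd hmem (notMem_empty _)
  have heq : (univ.filter fun i => u i = 0) = univ.filter fun i => w i = 0 :=
    Finset.eq_of_subset_of_card_le hsub hZ.ge
  have hZw : ∀ i, u i = 0 ↔ w i = 0 := fun i => by
    have := congrArg (fun s : Finset (Fin n) => i ∈ s) heq
    simpa using this
  apply huw
  funext i
  have hfin : ∀ a : Fin 3, a = 0 ∨ a = 1 ∨ a = 2 := by decide
  rcases hfin (u i) with h0 | h1 | h2
  · rw [h0, ((hZw i).1 h0)]
  · rw [h1, ((hOw i).1 h1)]
  · rcases hfin (w i) with g0 | g1 | g2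
    · have := (hZw i).2 g0
      rw [h2] at this
      exact absurd this (by decide)
    · have := (hOw i).2 g1
      rw [h2] at this
      exact absurd this (by decide)
    · rw [h2, g2]

end Summit.MatrixMultiplication.MatrixMultiplication.Theorems.SkewLocalStrongUSP.Negative
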